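import Summits.Langlands.Langlands.Theses.IrreducibilityBySelfDuality
import Summits.Langlands.Langlands.Theorems.HalfIntegralTwistCM.Negative.ModulusParallel
import Literature.NumberTheory.Automorphic.ClozelAlgebraicityRankOne
import Literature.NumberTheory.Automorphic.IdeleNormDetGL

/-!
# Line `even-angular-square-root` for crux `HalfIntegralTwistCM` (stmt-Langlands-14036) — CHECKED SKELETON

Route `route-Langlands-IrreducibilityBySelfDuality`; crux decl
`Summit.Langlands.Langlands.Theses.IrreducibilityBySelfDuality.HalfIntegralTwistCM` (K CM; (i) `s₁-s₂ ∈ ℤ`,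
(ii) `s₁ ι - s₁ ῑ ∈ ℤ`, (iii) `(s₁-s₂) ι + (s₁-s₂) ῑ ∈ 2ℤ`, (iv) a `GL₁` datum `ω` of parameter `{s₁ ι + s₂ ι}`
⟹ a `GL₁` datum `χ` of parameter `{p ι}`, `p ι + s₁ ι ∈ ½ + ℤ`).

THE LINE (idea card `Ideas/even-angular-square-root.md`), in PARAMETER LANGUAGE — every statement is over
`CuspidalAutomorphicRepData 1 K h1` / `HasArchParameter`, the currency of the crux itself, so the composition is
exponent bookkeeping plus one `GL₁` dictionary lemma, all kernel-checked in this file: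

* `Θ := ω⁻¹ · λ` has parameter `F ι = n ι - E ι` (`E = s₁ + s₂` the parameter of `ω`; `λ` a weight-zero CM
  character with ANTISYMMETRIC INTEGER parameter `n`, `n ῑ = -n ι`, of parity `n ι ≡ (s₁-s₂) ι + 1 (mod 2)` — the
  parity corrector `parityVector`; it exists by `stub_cmAntisymmParam`, the ONLY place `IsCMField` is used; the
  `‖·‖` of the card is absorbed into the parity `+1`);
* the angular integers `F ι - F ῑ = 2 n ι - (E ι - E ῑ)` are EVEN ((ii)+(iii): `angularInteger_even`), so `F/2` is
  again automorphic by the field-uniform square-root lemma `stub_halfParam` ("over a totally complex field an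
  automorphic `GL₁` parameter with even angular integers has an automorphic half" = a Hecke character whose
  archimedean component has a continuous square root is a square up to a finite-order character);
* `p := F/2` works: `p ι + s₁ ι - ½ = ((s₁-s₂) ι + n ι - 1)/2 ∈ ℤ` (`half_param_bookkeeping`).

REGISTERED STUBS (2): `stub_halfParam` (HARDEST) and `stub_cmAntisymmParam`. PROVED HERE: the dictionary
(`exp_linear_separation`, `exists_heckeCharacter_expFormula`, `isAutoParam_of_expFormula`, `isAutoParam_sub`), the
bookkeeping, the implication `crux_of_halfParam_of_cmAntisymmParam : HalfParam → CMAntisymmParam → Crux` (axioms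
standard), the audited skeleton theorem `HalfIntegralTwistCM_of`, AND the reductions of both stubs to Weil's unit
criterion: `halfParam_of_weil : Patrikis2019_heckeCharacter_archType_iff_units → UnitRelationWeilForm → HalfParam`,
`cmAntisymmParam_of_weil : Patrikis2019_heckeCharacter_archType_iff_units → CMAntisymmParam`, hence
`crux_of_weil` — the crux holds modulo the ACCEPTED named fact (⇐ direction only is used) and the disprover's
sorry-free necessity lemma `unit_relation_weilForm_glOne` (Disproof §10b, landing as `Negative/UnitRelationWeilForm`;
quoted here as the Prop `UnitRelationWeilForm` so that nothing unlanded is imported).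

Disproof obligations honoured (`Cruxes/HalfIntegralTwistCM/Disproof.lean`, gen 2, re-read 2026-08-16T06Z): F2 (ii) is
consumed in `angularInteger_even` (evenness of `E ι - E ῑ` = hypothesis of `stub_halfParam`); F6 (iii) idem and in
`parityVector_parity`; F7 (iv) is the automorphy input of `isAutoParam_sub`; F4/F11: `IsCMField` (not merely totally
complex) is the hypothesis of `stub_cmAntisymmParam` — over the non-CM sextic `K₆` of §11 the antisymmetric parameter
`𝟙_{ι₀} - 𝟙_{ῑ₀}` is NOT automorphic (`not_weilHypothesis_blind_of_isTotallyComplex`), while `stub_halfParam` is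
honestly field-uniform (totally complex suffices: F10b); F9 (shifts depend on ι): `p ι - (½ - s₁ ι)` varies with ι
through `n`; F3(a): (i) only NAMES `k = s₁ - s₂`; F3(c): no unitary/real claim on `p`. No stub fixes `p := ½ - s₁` or a
uniform shift (refuted, `Negative/ExactShift`).
-/

set_option linter.dupNamespace false

noncomputable section

open scoped ComplexConjugate NumberField Classical
open NumberField NumberField.InfinitePlace NumberField.ComplexEmbedding
open Literature.NumberTheory.Automorphic
open Literature.NumberTheory.GaloisRepresentations
open Summit.Langlands.Langlands.Theorems.HalfIntegralTwistCM

namespace Summit.Langlands.Langlands.Cruxes.HalfIntegralTwistCM.EvenAngularSquareRoot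

/-- The crux under attack, by name (alias used only by the helper implications; the audited skeleton theorem
`HalfIntegralTwistCM_of` concludes the route decl literally). -/
abbrev Crux : Prop := Summit.Langlands.Langlands.Theses.IrreducibilityBySelfDuality.HalfIntegralTwistCM

/-- `E` is the archimedean parameter of some cuspidal (= automorphic, rank one) `GL₁` datum over `K`. -/
abbrev IsAutoParam (K : Type) [Field K] [NumberField K] (h1 : isCompact_glFiniteIntegralLevel 1 K)
    (E : (K →+* ℂ) → ℂ) : Prop :=
  ∃ π : CuspidalAutomorphicRepData 1 K h1, π.1.HasArchParameter (fun ι => ({E ι} : Multiset ℂ))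

/-! ## The two stubs (statement `abbrev`s + registered `stub_*` theorems carrying the SAME literal text) -/

/-- STATEMENT B1 — **Hecke square roots modulo finite order, parameter form** (field-uniform; Patrikis
arXiv:1207.6724 Cor. 2.1.8 in existence form): over a TOTALLY COMPLEX number field an automorphic `GL₁` parameter
`E` all of whose angular integers `E ι - E ῑ` are EVEN has an automorphic half `E/2`. -/
abbrev HalfParam : Prop :=
  ∀ (K : Type) [Field K] [NumberField K] [IsTotallyComplex K] (h1 : isCompact_glFiniteIntegralLevel 1 K)
    (E : (K →+* ℂ) → ℂ), (∀ ι : K →+* ℂ, ∃ n : ℤ, E ι - E (conjugate ι) = 2 * n) →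
    (∃ Θ : CuspidalAutomorphicRepData 1 K h1, Θ.1.HasArchParameter (fun ι => ({E ι} : Multiset ℂ))) →
      ∃ ψ : CuspidalAutomorphicRepData 1 K h1, ψ.1.HasArchParameter (fun ι => ({E ι / 2} : Multiset ℂ))

/-- STATEMENT B2 — **weight-zero CM characters, parameter form** (the ONLY use of `IsCMField`; Chevalley-free):
over a CM field every conjugation-ANTISYMMETRIC integer vector `n` (`n ῑ = -n ι`) is an automorphic `GL₁` parameter. -/
abbrev CMAntisymmParam : Prop :=
  ∀ (K : Type) [Field K] [NumberField K], IsCMField K → ∀ (h1 : isCompact_glFiniteIntegralLevel 1 K)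
    (n : (K →+* ℂ) → ℤ), (∀ ι : K →+* ℂ, n (conjugate ι) = -n ι) →
      ∃ π : CuspidalAutomorphicRepData 1 K h1, π.1.HasArchParameter (fun ι => ({((n ι : ℤ) : ℂ)} : Multiset ℂ))

/-- **stub B1 (`HalfParam`, HARDEST).** Over a totally complex number field an automorphic `GL₁` parameter with even
angular integers has an automorphic half. TRUE modulo Weil (⇐) + necessity: `halfParam_of_weil` below. Sorry-free
plan for the lead: `Θ ↦ θ_Θ` (`exists_heckeCharacter_glOne`); Weil necessity in Weil form (`unit_relation_weilForm_glOne`,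
Disproof §10b, no named fact); the half type `(n_w, t_w/2)` has Weil product `f` with `f² =` that of `θ_Θ`
(`archUnitaryValue_half_sq`), so `f` is QUADRATIC on the congruence units `U_𝔥` (`𝔥` a level of `θ_Θ`,
`exists_level_glOne`) ⟹ kills `U_𝔤` by 2-power Chevalley mod torsion + odd-index absorption
(`SketchIdeator1.oddIndexAbsorption`, proved) ⟹ Weil/Tate extension in congruence form (= sibling stub A2/tateSeed)
⟹ `isAutoParam_of_expFormula` (this file) reads off the parameter `E/2`. -/
theorem stub_halfParam :
    ∀ (K : Type) [Field K] [NumberField K] [IsTotallyComplex K] (h1 : isCompact_glFiniteIntegralLevel 1 K)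
    (E : (K →+* ℂ) → ℂ), (∀ ι : K →+* ℂ, ∃ n : ℤ, E ι - E (conjugate ι) = 2 * n) →
    (∃ Θ : CuspidalAutomorphicRepData 1 K h1, Θ.1.HasArchParameter (fun ι => ({E ι} : Multiset ℂ))) →
      ∃ ψ : CuspidalAutomorphicRepData 1 K h1, ψ.1.HasArchParameter (fun ι => ({E ι / 2} : Multiset ℂ)) := by
  sorry

/-- **stub B2 (`CMAntisymmParam`).** Over a CM field every antisymmetric integer vector is an automorphic `GL₁`
parameter. TRUE modulo Weil (⇐): `cmAntisymmParam_of_weil` below (blindness `(ι u/|ι u|)^{2 w_K} = 1`). Sorry-free,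
CHEVALLEY-FREE plan for the lead: the unitary type `(2 n(σ_w), 0)` is trivial on the REAL congruence units `U_a`
(`a ≥ 3`: `μ(K) ∩ U_a = 1`, and `u ∈ U_a` CM ⟹ `u/ū ∈ μ(K) ∩ U_a` ⟹ `u` real ⟹ `(±1)^{2n} = 1`) — a congruence subgroup
outright — then the extension lemma (A2/tateSeed) and `isAutoParam_of_expFormula`. -/
theorem stub_cmAntisymmParam :
    ∀ (K : Type) [Field K] [NumberField K], IsCMField K → ∀ (h1 : isCompact_glFiniteIntegralLevel 1 K)
    (n : (K →+* ℂ) → ℤ), (∀ ι : K →+* ℂ, n (conjugate ι) = -n ι) →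
      ∃ π : CuspidalAutomorphicRepData 1 K h1, π.1.HasArchParameter (fun ι => ({((n ι : ℤ) : ℂ)} : Multiset ℂ)) := by
  sorry

/-! ## PROVED: the `GL₁` dictionary over a totally complex field -/

section Dictionary

variable {K : Type} [Field K]

theorem conjugate_conjugate (ι : K →+* ℂ) : conjugate (conjugate ι) = ι :=
  RingHom.ext fun x => by simp

/-- Over a totally complex field no embedding is its own conjugate. -/
theorem conjugate_ne_self [IsTotallyComplex K] (ι : K →+* ℂ) : conjugate ι ≠ ι := fun h =>
  IsTotallyComplex.complexEmbedding_not_isReal ι (ComplexEmbedding.isReal_iff.mpr h)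

variable [NumberField K]

/-- The archimedean one-parameter idele `det (exp a_w, 1)` at a complex place `w`. -/
local notation "dexp[" K' ", " w ", " a "]" =>
  Matrix.GeneralLinearGroup.det (GLn.ofInfinite 1 K' (expGL (complexPlaceLie 1 w (a • (1 : Matrix (Fin 1) (Fin 1) ℂ)))))

/-- SEPARATION: the exponential-linear character `a ↦ e^{a p + ā q}` of `ℂ` determines `(p, q)` (real directions give
`p + q`, imaginary directions give `p - q`). -/
theorem exp_linear_separation {p q p' q' : ℂ}
    (h : ∀ a : ℂ, Complex.exp (a * p + conj a * q) = Complex.exp (a * p' + conj a * q')) : p = p' ∧ q = q' := by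
  have hsum : p + q = p' + q' := by
    refine eq_of_forall_cexp_mul_eq fun s => ?_
    have h1 := h s
    rw [Complex.conj_ofReal] at h1
    rw [mul_add, mul_add]
    exact h1
  have hdiff : Complex.I * (p - q) = Complex.I * (p' - q') := by
    refine eq_of_forall_cexp_mul_eq fun s => ?_
    have h1 := h (s * Complex.I)
    rw [map_mul, Complex.conj_ofReal, Complex.conj_I] at h1
    rw [show (s : ℂ) * (Complex.I * (p - q)) = s * Complex.I * p + s * -Complex.I * q by ring,
      show (s : ℂ) * (Complex.I * (p' - q')) = s * Complex.I * p' + s * -Complex.I * q' by ring]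
    exact h1
  have hdiff' := mul_left_cancel₀ Complex.I_ne_zero hdiff
  exact ⟨by linear_combination (hsum + hdiff') / 2, by linear_combination (hsum - hdiff') / 2⟩

/-- READ: an automorphic parameter `E` comes with a Hecke character `θ` whose values on the archimedean one-parameter
subgroups are `θ(det (exp a_w, 1)) = e^{a E σ_w + ā E σ̄_w}` (`archParam_complexPlace_glOne` of the landed Negative
file + pinning of the singleton parameter). -/
theorem exists_heckeCharacter_expFormula {h1 : isCompact_glFiniteIntegralLevel 1 K} {E : (K →+* ℂ) → ℂ}
    (hE : IsAutoParam K h1 E) :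
    ∃ θ : HeckeCharacter K, ∀ (w : {w : InfinitePlace K // w.IsComplex}) (a : ℂ),
      ((θ dexp[K, w, a] : ℂˣ) : ℂ) = Complex.exp (a * E w.1.embedding + conj a * E (conjugate w.1.embedding)) := by
  obtain ⟨π, hP⟩ := hE
  obtain ⟨θ, hθ⟩ := π.1.exists_heckeCharacter_glOne
  refine ⟨θ, fun w a => ?_⟩
  obtain ⟨p, q, hp, hq, hval⟩ := Negative.archParam_complexPlace_glOne π.1 hθ hP w
  have ep : p = E w.1.embedding := (Multiset.singleton_inj.1 hp).symm
  have eq : q = E (conjugate w.1.embedding) := (Multiset.singleton_inj.1 hq).symm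
  rw [hval a, ep, eq]

/-- WRITE: conversely, over a TOTALLY COMPLEX field, if a Hecke character `θ` satisfies
`θ(det (exp a_w, 1)) = e^{a E σ_w + ā E σ̄_w}` at every (complex) place, then `E` is automorphic: the datum `π_θ`
(`exists_cuspidal_detTwist_glOne`) has parameter `E` (separation + every embedding is `σ_w` or `σ̄_w`). -/
theorem isAutoParam_of_expFormula [IsTotallyComplex K] (h1 : isCompact_glFiniteIntegralLevel 1 K)
    (θ : HeckeCharacter K) (E : (K →+* ℂ) → ℂ)
    (h : ∀ (w : {w : InfinitePlace K // w.IsComplex}) (a : ℂ),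
      ((θ dexp[K, w, a] : ℂˣ) : ℂ) = Complex.exp (a * E w.1.embedding + conj a * E (conjugate w.1.embedding))) :
    IsAutoParam K h1 E := by
  obtain ⟨π, hW, -⟩ := exists_cuspidal_detTwist_glOne h1 θ
  have hθ := heckeCharacter_detTwist_glOne (hcpt := h1) hW
  obtain ⟨P, hP⟩ := π.1.exists_hasArchParameter_glOne
  suffices hPE : P = fun ι => ({E ι} : Multiset ℂ) by
    subst hPE
    exact ⟨π, hP⟩
  funext ι
  set w : {w : InfinitePlace K // w.IsComplex} := ⟨InfinitePlace.mk ι, IsTotallyComplex.isComplex _⟩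
  obtain ⟨p, q, hp, hq, hval⟩ := Negative.archParam_complexPlace_glOne π.1 hθ hP w
  obtain ⟨hpE, hqE⟩ := exp_linear_separation (p' := E w.1.embedding) (q' := E (conjugate w.1.embedding))
    (fun a => (hval a).symm.trans (h w a))
  rcases embedding_mk_eq ι with hι | hι
  · -- `σ_w = ι`
    have hwι : w.1.embedding = ι := hι
    have h' : P ι = {p} := by rw [← hwι]; exact hp
    rw [h', hpE, hwι]
  · -- `σ_w = ῑ`
    have hwι : conjugate (w.1.embedding) = ι := by
      rw [show (w.1).embedding = conjugate ι from hι, conjugate_conjugate]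
    have h' : P ι = {q} := by rw [← hwι]; exact hq
    rw [h', hqE, hwι]

/-- **Automorphic `GL₁` parameters over a totally complex field are closed under subtraction** (the datum of
`θ₁ θ₂⁻¹`). [folklore: Tate's thesis §2.3; Clozel 1990 §3.3] -/
theorem isAutoParam_sub [IsTotallyComplex K] {h1 : isCompact_glFiniteIntegralLevel 1 K} {E₁ E₂ : (K →+* ℂ) → ℂ}
    (hE₁ : IsAutoParam K h1 E₁) (hE₂ : IsAutoParam K h1 E₂) : IsAutoParam K h1 (fun ι => E₁ ι - E₂ ι) := by
  obtain ⟨θ₁, hθ₁⟩ := exists_heckeCharacter_expFormula hE₁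
  obtain ⟨θ₂, hθ₂⟩ := exists_heckeCharacter_expFormula hE₂
  refine isAutoParam_of_expFormula h1 (θ₁ * θ₂⁻¹) _ fun w a => ?_
  beta_reduce
  rw [HeckeCharacter.mul_apply, HeckeCharacter.inv_apply, Units.val_mul, Units.val_inv_eq_inv_val, hθ₁ w a,
    hθ₂ w a, ← Complex.exp_neg, ← Complex.exp_add]
  congr 1
  ring

/-! ### Weil's local factors on the one-parameter subgroups -/

/-- `(e^x)^s = e^{x s}` for real `x` (principal power of a positive real; Disproof §10b). -/
theorem ofReal_exp_cpow (x : ℝ) (s : ℂ) : ((Real.exp x : ℝ) : ℂ) ^ s = Complex.exp (x * s) := by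
  have hpos : (0 : ℝ) < Real.exp x := Real.exp_pos x
  have hne : ((Real.exp x : ℝ) : ℂ) ≠ 0 := by exact_mod_cast hpos.ne'
  rw [Complex.cpow_def_of_ne_zero hne, Complex.ofReal_exp,
    Complex.log_exp (by simp [Real.pi_pos]) (by simpa using Real.pi_pos.le)]

/-- Weil's unitary local factor `(z/|z|)^m |z|^{it}` at `z = e^a` is the exponential-linear character with
exponents `p = (m + it)/2`, `q = (-m + it)/2` (the bridge of card torsion-blind / Disproof §10b, purely unitary case). -/
theorem archUnitaryValue_exp (m : ℤ) (t : ℝ) (a : ℂ) :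
    archUnitaryValue m t (Complex.exp a) =
      Complex.exp (a * (((m : ℂ) + t * Complex.I) / 2) + conj a * ((-(m : ℂ) + t * Complex.I) / 2)) := by
  obtain ⟨x, y, rfl⟩ : ∃ x y : ℝ, a = x + y * Complex.I := ⟨a.re, a.im, (Complex.re_add_im a).symm⟩
  have hre : ((x : ℂ) + y * Complex.I).re = x := by simp
  have hnorm : ‖Complex.exp (x + y * Complex.I)‖ = Real.exp x := by rw [Complex.norm_exp, hre]
  have hratio : Complex.exp (x + y * Complex.I) / (‖Complex.exp (x + y * Complex.I)‖ : ℂ) =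
      Complex.exp (y * Complex.I) := by
    rw [hnorm, Complex.ofReal_exp, ← Complex.exp_sub]
    congr 1; ring
  unfold archUnitaryValue
  rw [hratio, hnorm, ofReal_exp_cpow, ← Complex.exp_int_mul, ← Complex.exp_add]
  congr 1
  simp only [map_add, map_mul, Complex.conj_ofReal, Complex.conj_I]
  ring

/-- HALVING for EVEN angular degree: `((z/|z|)^n |z|^{it/2})² = (z/|z|)^{2n} |z|^{it}`. -/
theorem archUnitaryValue_half_sq (n : ℤ) (t : ℝ) (z : ℂ) :
    archUnitaryValue n (t / 2) z ^ 2 = archUnitaryValue (2 * n) t z := by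
  unfold archUnitaryValue
  rw [mul_pow, ← Complex.cpow_nat_mul]
  congr 1
  · rw [← zpow_natCast ((z / (‖z‖ : ℂ)) ^ n) 2, ← zpow_mul]
    congr 1
    push_cast
    ring
  · congr 1
    push_cast
    ring

/-- A unitary Hecke character of archimedean type `(m, t)` on the archimedean one-parameter subgroup at a complex
place `w`: `ψ(det (exp a_w, 1)) = e^{a (m_w + i t_w)/2 + ā (-m_w + i t_w)/2}`. -/
theorem hasUnitaryArchType_dexp {ψ : HeckeCharacter K} {m : InfinitePlace K → ℤ} {t : InfinitePlace K → ℝ}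
    (hψ : ψ.HasUnitaryArchType m t) (w : {w : InfinitePlace K // w.IsComplex}) (a : ℂ) :
    ((ψ dexp[K, w, a] : ℂˣ) : ℂ) =
      Complex.exp (a * (((m w.1 : ℂ) + t w.1 * Complex.I) / 2) + conj a * ((-(m w.1 : ℂ) + t w.1 * Complex.I) / 2)) := by
  have hx := hψ (HeckeCharacter.infPart K dexp[K, w, a])
  rw [infiniteIdeles_infPart_det_ofInfinite_expGL] at hx
  simp only [HeckeCharacter.val_infPart] at hx
  simp_rw [extensionEmbedding_det_ofInfinite_expGL_complexPlaceLie K w] at hx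
  rw [Finset.prod_eq_single w.1 (fun w' _ hw' => by rw [if_neg hw', Negative.archUnitaryValue_one])
    (fun h => absurd (Finset.mem_univ _) h), if_pos rfl, archUnitaryValue_exp] at hx
  exact hx

/-- The norm-power character `‖·‖^s` (`s` real) on the archimedean one-parameter subgroup at a complex place:
`‖det (exp a_w, 1)‖^s = e^{2 s Re a} = e^{a s + ā s}`. -/
theorem normPow_dexp {χ : HeckeCharacter K} {s : ℝ}
    (hχ : ∀ x : ideleGroup K, ((χ x : ℂˣ) : ℂ) = (Literature.NumberTheory.GaloisRepresentations.ideleNorm x : ℂ) ^ ((s : ℝ) : ℂ))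
    (w : {w : InfinitePlace K // w.IsComplex}) (a : ℂ) :
    ((χ dexp[K, w, a] : ℂˣ) : ℂ) = Complex.exp (a * s + conj a * s) := by
  rw [hχ, Negative.ideleNorm_det_ofInfinite_expGL_complexPlaceLie,
    show Real.exp a.re ^ 2 = Real.exp (2 * a.re) by
      rw [show (2 : ℝ) * a.re = ((2 : ℕ) : ℝ) * a.re by norm_num, Real.exp_nat_mul],
    ofReal_exp_cpow]
  congr 1
  have hare : 2 * (a.re : ℂ) = a + conj a := by
    have h := Complex.add_conj a
    push_cast at h
    exact h.symm
  push_cast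
  linear_combination (s : ℂ) * hare

end Dictionary

/-! ## PROVED: the two stubs modulo Weil's unit criterion (⇐) — certificates of truth, and the named-fact route -/

/-- Weil NECESSITY in Weil form for `GL₁` data over a totally complex field — VERBATIM the disprover's sorry-free
`unit_relation_weilForm_glOne` (Disproof §10b; landing as `Negative/UnitRelationWeilForm`), quoted as a Prop so that
this file imports nothing unlanded; discharge with `fun K _ _ _ h1 ω e hω me hme => unit_relation_weilForm_glOne ω e hω me hme`. -/
abbrev UnitRelationWeilForm : Prop :=
  ∀ (K : Type) [Field K] [NumberField K] [IsTotallyComplex K] (h1 : isCompact_glFiniteIntegralLevel 1 K)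
    (ω : CuspidalAutomorphicRepData 1 K h1) (e : (K →+* ℂ) → ℂ),
    ω.1.HasArchParameter (fun ι => ({e ι} : Multiset ℂ)) →
    ∀ (me : InfinitePlace K → ℤ), (∀ w : InfinitePlace K, e w.embedding - e (conjugate w.embedding) = me w) →
      ∃ M : ℕ, 0 < M ∧ ∀ α : (𝓞 K)ˣ,
        (∏ w : InfinitePlace K, archUnitaryValue (me w) ((e w.embedding + e (conjugate w.embedding)).im)
          (w.embedding ((α : 𝓞 K) : K))) ^ M = 1

section Blind

open NumberField.Units

variable (K : Type) [Field K] [NumberField K] [IsCMField K]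

/-- CM TORSION (Kronecker; Mathlib `IsCMField.unitsMulComplexConjInv`): for a unit `α` of a CM field and any
embedding `φ`, `φ α / conj (φ α) = φ (α ᾱ⁻¹)` is a root of unity of order dividing `w_K`. (Card torsion-blind.) -/
theorem embedding_div_conj_pow_torsionOrder (φ : K →+* ℂ) (α : (𝓞 K)ˣ) :
    ((φ ((α : 𝓞 K) : K)) / conj (φ ((α : 𝓞 K) : K))) ^ torsionOrder K = 1 := by
  have hζmem : ((IsCMField.unitsMulComplexConjInv K α : torsion K) : (𝓞 K)ˣ) ∈
      rootsOfUnity (torsionOrder K) (𝓞 K) := by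
    rw [rootsOfUnity_eq_torsion]; exact Subtype.coe_prop _
  have hζ : (((IsCMField.unitsMulComplexConjInv K α : torsion K) : (𝓞 K)ˣ)) ^ torsionOrder K = 1 :=
    (mem_rootsOfUnity _ _).mp hζmem
  have hconj : φ ((((IsCMField.unitsComplexConj K α : (𝓞 K)ˣ) : 𝓞 K) : K)) =
      conj (φ ((α : 𝓞 K) : K)) := by
    rw [← IsCMField.complexEmbedding_complexConj K φ]
    rfl
  have hval : ((Units.complexEmbedding φ
      ((IsCMField.unitsMulComplexConjInv K α : torsion K) : (𝓞 K)ˣ) : ℂˣ) : ℂ) =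
      φ ((α : 𝓞 K) : K) / conj (φ ((α : 𝓞 K) : K)) := by
    rw [IsCMField.unitsMulComplexConjInv_apply, map_mul, map_inv, Units.val_mul,
      Units.val_inv_eq_inv_val, Units.complexEmbedding_apply, Units.complexEmbedding_apply, hconj,
      div_eq_mul_inv]
  have h := congrArg (fun u : (𝓞 K)ˣ => ((Units.complexEmbedding φ u : ℂˣ) : ℂ)) hζ
  simp only [map_pow, map_one, Units.val_pow_eq_pow_val, Units.val_one] at h
  rwa [hval] at h

/-- BLINDNESS CORE: `(φ α / |φ α|)^(2 w_K) = 1` for every unit of a CM field, because `(z/|z|)² = z / conj z`. -/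
theorem embedding_div_norm_pow_eq_one (φ : K →+* ℂ) (α : (𝓞 K)ˣ) :
    ((φ ((α : 𝓞 K) : K)) / (‖φ ((α : 𝓞 K) : K)‖ : ℂ)) ^ (2 * torsionOrder K) = 1 := by
  set z : ℂ := φ ((α : 𝓞 K) : K) with hz
  have hz0 : z ≠ 0 := by
    rw [hz, map_ne_zero]
    exact_mod_cast Units.ne_zero α
  have hsq : (z / (‖z‖ : ℂ)) ^ 2 = z / conj z := by
    have hn : (‖z‖ : ℂ) ≠ 0 := by exact_mod_cast (norm_ne_zero_iff.mpr hz0)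
    have hc : conj z ≠ 0 := (map_ne_zero _).mpr hz0
    have hnorm : ((‖z‖ : ℂ)) ^ 2 = z * conj z := by
      rw [Complex.mul_conj, Complex.normSq_eq_norm_sq]; push_cast; ring
    field_simp
    rw [hnorm]
    try ring
  rw [pow_mul, hsq]
  exact embedding_div_conj_pow_torsionOrder K φ α

end Blind

/-- **B2 modulo Weil (⇐)**: over a CM field every antisymmetric integer vector is automorphic — the unitary type
`(2 n(σ_w), 0)` satisfies Weil's unit condition with exponent `w_K` (blindness), and its datum has parameter `n`. -/
theorem cmAntisymmParam_of_weil (hW : Patrikis2019_heckeCharacter_archType_iff_units) : CMAntisymmParam := by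
  intro K _ _ hK h1 n hn
  haveI : IsCMField K := hK
  -- Weil's unit condition for the type `(2 n(σ_w), 0)`
  have hunit : ∃ M : ℕ, 0 < M ∧ ∀ α : (𝓞 K)ˣ,
      (∏ w : InfinitePlace K, archUnitaryValue ((fun w : InfinitePlace K => 2 * n w.embedding) w)
        ((fun _ : InfinitePlace K => (0 : ℝ)) w) (w.embedding ((α : 𝓞 K) : K))) ^ M = 1 := by
    refine ⟨NumberField.Units.torsionOrder K, NumberField.Units.torsionOrder_pos K, fun α => ?_⟩
    rw [← Finset.prod_pow]
    refine Finset.prod_eq_one fun w _ => ?_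
    beta_reduce
    unfold archUnitaryValue
    rw [Complex.ofReal_zero, zero_mul, Complex.cpow_zero, mul_one, ← zpow_natCast, ← zpow_mul,
      show 2 * n w.embedding * ((NumberField.Units.torsionOrder K : ℕ) : ℤ) =
        ((2 * NumberField.Units.torsionOrder K : ℕ) : ℤ) * n w.embedding by push_cast; ring,
      zpow_mul, zpow_natCast, embedding_div_norm_pow_eq_one K w.embedding α, one_zpow]
  obtain ⟨ψ, -, hψ⟩ := (hW K (fun w => 2 * n w.embedding) (fun _ => 0)).mpr hunit
  -- its datum has parameter `n`
  refine isAutoParam_of_expFormula h1 ψ (fun ι => ((n ι : ℤ) : ℂ)) fun w a => ?_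
  beta_reduce
  rw [hasUnitaryArchType_dexp hψ w a, hn w.1.embedding]
  congr 1
  push_cast
  ring

/-- **B1 modulo Weil (⇐) and Weil necessity**: halve an even-angular automorphic parameter over a totally complex
field. `θ_Θ` has Weil type `(2 n_w, t_w)` (necessity, `t_w = Im (E σ_w + E σ̄_w)`); the half type `(n_w, t_w/2)`
satisfies Weil's condition with twice the exponent (`archUnitaryValue_half_sq`); Weil (⇐) gives a unitary `ψ₁`; the
datum of `ψ₁ · ‖·‖^{σ/2}` (`2σ = Re (E σ_w + E σ̄_w)`, parallel by `exists_re_archParam_parallel_glOne`) has parameter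
`E/2` (`isAutoParam_of_expFormula`). -/
theorem halfParam_of_weil (hW : Patrikis2019_heckeCharacter_archType_iff_units) (hN : UnitRelationWeilForm) :
    HalfParam := by
  intro K _ _ _ h1 E heven hΘ
  obtain ⟨Θ, hΘP⟩ := hΘ
  choose nE hnE using heven
  -- the real weight `σ`
  obtain ⟨σ, -, hpar⟩ := Negative.exists_re_archParam_parallel_glOne Θ.1 hΘP
  have hre : ∀ w : InfinitePlace K, (E w.embedding + E (conjugate w.embedding)).re = 2 * σ := fun w =>
    hpar ⟨w, IsTotallyComplex.isComplex w⟩ _ _ rfl rfl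
  -- Weil necessity for `Θ`, type `(2 n_w, t_w)`
  obtain ⟨M, hM, hrel⟩ := hN K h1 Θ E hΘP (fun w => 2 * nE w.embedding)
    (fun w => by push_cast; exact hnE w.embedding)
  -- Weil's condition for the half type `(n_w, t_w / 2)`
  have hunit : ∃ M' : ℕ, 0 < M' ∧ ∀ α : (𝓞 K)ˣ,
      (∏ w : InfinitePlace K, archUnitaryValue ((fun w : InfinitePlace K => nE w.embedding) w)
        ((fun w : InfinitePlace K => (E w.embedding + E (conjugate w.embedding)).im / 2) w)
          (w.embedding ((α : 𝓞 K) : K))) ^ M' = 1 := by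
    refine ⟨2 * M, by omega, fun α => ?_⟩
    beta_reduce
    rw [pow_mul, ← Finset.prod_pow]
    simp_rw [archUnitaryValue_half_sq]
    exact hrel α
  obtain ⟨ψ₁, -, hψ₁⟩ := (hW K (fun w => nE w.embedding)
    (fun w => (E w.embedding + E (conjugate w.embedding)).im / 2)).mpr hunit
  -- the norm part `‖·‖^{σ/2}`
  obtain ⟨χn, hχn⟩ := exists_heckeCharacter_ideleNorm_cpow K (((σ / 2 : ℝ)) : ℂ)
  -- `ψ₁ · ‖·‖^{σ/2}` has the exponential formula of `E/2`
  refine isAutoParam_of_expFormula h1 (ψ₁ * χn) (fun ι => E ι / 2) fun w a => ?_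
  beta_reduce
  have hsumE : E w.1.embedding + E (conjugate w.1.embedding) =
      2 * (σ : ℂ) + ((E w.1.embedding + E (conjugate w.1.embedding)).im : ℂ) * Complex.I :=
    Complex.ext (by simp [hre w.1]) (by simp)
  have hdiffE := hnE w.1.embedding
  rw [HeckeCharacter.mul_apply, Units.val_mul, hasUnitaryArchType_dexp hψ₁ w a, normPow_dexp hχn w a,
    ← Complex.exp_add]
  congr 1
  push_cast
  linear_combination (-(a + conj a) / 4) * hsumE - ((a - conj a) / 4) * hdiffE

/-! ## PROVED: exponent bookkeeping -/

section Bookkeeping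

variable {K : Type} [Field K]

/-- The angular integers of `E = s₁ + s₂` are EVEN under (ii)+(iii) (pure algebra; this is where hypothesis (ii) of the
crux — load-bearing by Disproof F2 — is consumed). -/
theorem angularInteger_even (s₁ s₂ s₁c s₂c : ℂ) (kc m M : ℤ)
    (hkc : s₁c - s₂c = kc) (hm : s₁ - s₁c = m) (hM : (s₁ - s₂) + (s₁c - s₂c) = 2 * M) :
    (s₁ + s₂) - (s₁c + s₂c) = 2 * ((m - M + kc : ℤ) : ℂ) := by
  push_cast
  linear_combination 2 * hm - hM + 2 * hkc

/-- HALF-PARAMETER BOOKKEEPING: with `p = (n - (s₁ + s₂))/2`, `s₁ - s₂ = k` and `n = k + 1 + 2 j`,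
`p + s₁ - ½ = k + j ∈ ℤ`. -/
theorem half_param_bookkeeping (s₁ s₂ : ℂ) (k n j : ℤ) (hk : s₁ - s₂ = k) (hn : n = k + 1 + 2 * j) :
    ((n : ℂ) - (s₁ + s₂)) / 2 + s₁ - 1 / 2 = ((k + j : ℤ) : ℂ) := by
  have hn' : (n : ℂ) = k + 1 + 2 * j := by exact_mod_cast hn
  rw [hn']
  push_cast
  linear_combination (1 / 2 : ℂ) * hk

/-- THE PARITY VECTOR: put `k ι + 1` on ONE embedding of each conjugate pair and antisymmetrise. -/
def parityVector (k : (K →+* ℂ) → ℤ) (ι : K →+* ℂ) : ℤ :=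
  (if (InfinitePlace.mk ι).embedding = ι then k ι + 1 else 0) -
    (if (InfinitePlace.mk (conjugate ι)).embedding = conjugate ι then k (conjugate ι) + 1 else 0)

theorem parityVector_antisymm (k : (K →+* ℂ) → ℤ) (ι : K →+* ℂ) :
    parityVector k (conjugate ι) = -parityVector k ι := by
  simp only [parityVector, conjugate_conjugate]
  ring

/-- Over a totally complex field the parity vector has the parity of `k + 1` at EVERY embedding, provided
`k ι + k ῑ` is even (hypothesis (iii)). -/
theorem parityVector_parity [IsTotallyComplex K] (k : (K →+* ℂ) → ℤ)
    (hk : ∀ ι, ∃ M : ℤ, k ι + k (conjugate ι) = 2 * M) (ι : K →+* ℂ) :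
    ∃ j : ℤ, parityVector k ι = k ι + 1 + 2 * j := by
  have hne := conjugate_ne_self ι
  simp only [parityVector, InfinitePlace.mk_conjugate_eq]
  rcases embedding_mk_eq ι with h | h
  · refine ⟨0, ?_⟩
    rw [if_pos h, if_neg (by rw [h]; exact hne.symm)]
    ring
  · obtain ⟨M, hM⟩ := hk ι
    refine ⟨-M - 1, ?_⟩
    rw [if_neg (by rw [h]; exact hne), if_pos h]
    linear_combination (-1 : ℤ) * hM

end Bookkeeping

/-! ## The composition -/

/-- **B1 → B2 → crux** (kernel-checked; axioms `propext`, `Classical.choice`, `Quot.sound`). Hypothesis (i) is used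
only to NAME the integers `k ι = (s₁ - s₂) ι` (cf. Disproof F3(a)). -/
theorem crux_of_halfParam_of_cmAntisymmParam (hB1 : HalfParam) (hB2 : CMAntisymmParam) : Crux := by
  intro K _ _ hK h1 s₁ s₂ hi hii hiii hiv
  haveI : IsCMField K := hK
  -- the integers of (i), (ii), (iii)
  choose k hk using hi
  choose m hm using hii
  choose M hM using hiii
  have hkk : ∀ ι, ∃ M' : ℤ, k ι + k (conjugate ι) = 2 * M' := fun ι =>
    ⟨M ι, by have h := hM ι; rw [hk ι, hk (conjugate ι)] at h; exact_mod_cast h⟩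
  -- the parity corrector `n` and its character (B2: the CM input)
  set n : (K →+* ℂ) → ℤ := parityVector k with hn
  have hn_anti : ∀ ι, n (conjugate ι) = -n ι := parityVector_antisymm k
  have hlam : IsAutoParam K h1 (fun ι => ((n ι : ℤ) : ℂ)) := hB2 K hK h1 n hn_anti
  -- `Θ := ω⁻¹ λ`, parameter `F = n - E`
  set E : (K →+* ℂ) → ℂ := fun ι => s₁ ι + s₂ ι with hE
  have hω : IsAutoParam K h1 E := hiv
  have hΘ : IsAutoParam K h1 (fun ι => ((n ι : ℤ) : ℂ) - E ι) := isAutoParam_sub hlam hω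
  -- the angular integers of `F` are even
  have heven : ∀ ι : K →+* ℂ, ∃ N : ℤ,
      (((n ι : ℤ) : ℂ) - E ι) - (((n (conjugate ι) : ℤ) : ℂ) - E (conjugate ι)) = 2 * N := by
    intro ι
    have he := angularInteger_even (s₁ ι) (s₂ ι) (s₁ (conjugate ι)) (s₂ (conjugate ι))
      (k (conjugate ι)) (m ι) (M ι) (hk (conjugate ι)) (hm ι) (hM ι)
    refine ⟨n ι - (m ι - M ι + k (conjugate ι)), ?_⟩
    rw [hn_anti ι]
    simp only [hE]
    push_cast at he ⊢
    linear_combination (-1 : ℂ) * he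
  -- B1: halve
  obtain ⟨χ, hχ⟩ := hB1 K h1 (fun ι => ((n ι : ℤ) : ℂ) - E ι) heven hΘ
  refine ⟨χ, fun ι => (((n ι : ℤ) : ℂ) - E ι) / 2, hχ, fun ι => ?_⟩
  obtain ⟨j, hj⟩ := parityVector_parity k hkk ι
  refine ⟨k ι + j, ?_⟩
  have hb := half_param_bookkeeping (s₁ ι) (s₂ ι) (k ι) (n ι) j (hk ι) hj
  simp only [hE]
  linear_combination hb

/-- **The crux modulo Weil's unit criterion** (accepted named fact, ⇐ direction) and Weil necessity in Weil form
(sorry-free, Disproof §10b): a certificate that the line is sound. -/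
theorem crux_of_weil (hW : Patrikis2019_heckeCharacter_archType_iff_units) (hN : UnitRelationWeilForm) : Crux :=
  crux_of_halfParam_of_cmAntisymmParam (halfParam_of_weil hW hN) (cmAntisymmParam_of_weil hW)

/-- **THE SKELETON THEOREM** (audited: concludes the route decl BY NAME; `sorry` only inside the two registered
stubs `stub_halfParam`, `stub_cmAntisymmParam`). -/
theorem HalfIntegralTwistCM_of :
    Summit.Langlands.Langlands.Theses.IrreducibilityBySelfDuality.HalfIntegralTwistCM :=
  crux_of_halfParam_of_cmAntisymmParam stub_halfParam stub_cmAntisymmParam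

end Summit.Langlands.Langlands.Cruxes.HalfIntegralTwistCM.EvenAngularSquareRoot
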